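import Summits.ValiantsHypothesis.ValiantsHypothesis.Theorems.LacunarySymmetroidMatrixDescartesFiniteSector

/-!
# `MatrixDescartes` — line «finite»: the STAMP CEILING of the `K = 3` column in closed form,
# `ν(m,3) ≤ n(m,2)` for `m ≤ 7` (kernel), hence `ν(3,3) = 7`, `ν(4,3) = 10`, `ν(5,3) = 14` EXACT

HONEST FRAMING.  Object-search cell `pub-symmetroid`, seat val-sym-eng-3 g4.  HELPER of the crux item
`stmt-ValiantsHypothesis-18050` (`Theses.LacunarySymmetroid.MatrixDescartes`, asymptotic in `K`) with NO closure claim.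
The PROVED postage-stamp ceiling T3 of line «finite» (`…FiniteSector.mem_sumset_of_fullPos`, val-idea-6 g3 / port
eng-3 g3) says: a full-positive-rooted symmetric `(m,K)` half-pencil determinant of degree `n` has `[0,n]` inside the
`m`-fold sumset of its `K` exponents.  This file turns T3 into the NUMERIC rows of the `K = 3` column: with three
exponents the sumset condition forces the exponent values to be `{0, 1, x}` (from `0, 1 ∈` sumset), every `m`-fold sum
is `p + q·x` with `p + q ≤ m` (two denominations `1, x`, at most `m` stamps), and a finite check per `m` bounds the
covered initial segment by the classical two-denomination postage-stamp number `n(m,2) = ⌊(m²+6m+1)/4⌋` (Stöhr):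
`StampLawAt m 3 (n(m,2))` for `m = 2,…,7`, i.e. `ν(2,3) ≤ 4`, `ν(3,3) ≤ 7`, `ν(4,3) ≤ 10`, `ν(5,3) ≤ 14`,
`ν(6,3) ≤ 18`, `ν(7,3) ≤ 23`.  With the kernel witnesses of `…FiniteSectorRealisable` /
`…FiniteSectorRealisableKThree` (`FullyRealisable 3 ![0,1,3] 7`, `4 ![0,1,3] 10`, `5 ![0,1,4] 14`) the rows
`m = 3, 4, 5` are EXACT on both sides in the kernel.  Nothing here bears on the crux or on `VP ≠ VNP`.
[folklore] Postage-stamp (Rohrbach/Stöhr two-denomination) bookkeeping; no citation is load-bearing.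
-/

-- `Summit.ValiantsHypothesis.ValiantsHypothesis.…` repeats a component by the D-0017 layout
-- (single-conjunct summit), which the `dupNamespace` linter flags; the name is mandated.
set_option linter.dupNamespace false

namespace Summit.ValiantsHypothesis.ValiantsHypothesis.Theorems.LacunarySymmetroidMatrixDescartes.FiniteSector

open scoped BigOperators Matrix
open Polynomial

/-! ## §1 Three exponents whose sumset contains `0` and `1` take only the values `0, 1, x` -/

/-- If a multiset of exponent indices has `d`-sum `0`, some index carries the exponent `0` (when it is non-empty).
[folklore] -/
theorem exists_eq_zero_of_sum_eq_zero {K : ℕ} (d : Fin K → ℕ) (s : Multiset (Fin K)) (hs : s ≠ 0)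
    (h : (s.map d).sum = 0) : ∃ a, d a = 0 := by
  obtain ⟨i, hi⟩ := Multiset.exists_mem_of_ne_zero hs
  refine ⟨i, ?_⟩
  have : d i ≤ (s.map d).sum := Multiset.le_sum_of_mem (Multiset.mem_map_of_mem d hi)
  omega

/-- If a multiset of exponent indices has `d`-sum `1`, some index carries the exponent `1`. [folklore] -/
theorem exists_eq_one_of_sum_eq_one {K : ℕ} (d : Fin K → ℕ) :
    ∀ (s : Multiset (Fin K)), (s.map d).sum = 1 → ∃ b, d b = 1 := by
  intro s
  induction s using Multiset.induction_on with
  | empty => intro h; simp at h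
  | cons i t ih =>
    intro h
    rw [Multiset.map_cons, Multiset.sum_cons] at h
    by_cases hi : d i = 1
    · exact ⟨i, hi⟩
    · have h0 : d i = 0 := by omega
      exact ih (by omega)

/-- With the exponent values among `{0, 1, x}`, every multiset sum of exponents is `p + q·x` with `p + q ≤ card`
(the number of `1`-stamps and of `x`-stamps). [folklore] -/
theorem sum_eq_stamps {K : ℕ} (d : Fin K → ℕ) (x : ℕ) (hd : ∀ i, d i = 0 ∨ d i = 1 ∨ d i = x) :
    ∀ (s : Multiset (Fin K)), ∃ p q : ℕ, p + q ≤ Multiset.card s ∧ (s.map d).sum = p + q * x := by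
  intro s
  induction s using Multiset.induction_on with
  | empty => exact ⟨0, 0, by simp, by simp⟩
  | cons i t ih =>
    obtain ⟨p, q, hpq, hsum⟩ := ih
    rw [Multiset.map_cons, Multiset.sum_cons, Multiset.card_cons, hsum]
    rcases hd i with h | h | h
    · exact ⟨p, q, by omega, by rw [h]; ring⟩
    · exact ⟨p + 1, q, by omega, by rw [h]; ring⟩
    · exact ⟨p, q + 1, by omega, by rw [h]; ring⟩

/-- Three indices: if `d a = 0` and `d b = 1` then every value of `d : Fin 3 → ℕ` is `0`, `1` or the third value.
[folklore] -/
theorem values_fin_three (d : Fin 3 → ℕ) (a b : Fin 3) (ha : d a = 0) (hb : d b = 1) :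
    ∃ x, ∀ i, d i = 0 ∨ d i = 1 ∨ d i = x := by
  have hab : a ≠ b := fun h => by rw [h] at ha; omega
  -- the third index
  obtain ⟨c, hc⟩ : ∃ c : Fin 3, ∀ i : Fin 3, i = a ∨ i = b ∨ i = c := by
    fin_cases a <;> fin_cases b <;> first
      | exact absurd rfl hab
      | exact ⟨0, by decide⟩
      | exact ⟨1, by decide⟩
      | exact ⟨2, by decide⟩
  refine ⟨d c, fun i => ?_⟩
  rcases hc i with h | h | h
  · exact Or.inl (h ▸ ha)
  · exact Or.inr (Or.inl (h ▸ hb))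
  · exact Or.inr (Or.inr (h ▸ rfl))

/-! ## §2 The `K = 3` stamp ceiling from a two-denomination postage-stamp bound -/

/-- **`K = 3` stamp ceiling, abstract form.**  If no `x` lets the stamps `{1, x}` (at most `m` of them) cover
`[0, N+1]` — formally: for every `x` some `r ≤ N + 1` is not of the form `p + q·x` with `p + q ≤ m` — then every
full-positive-rooted symmetric `(m,3)` half-pencil determinant has degree `≤ N`: `StampLawAt m 3 N`.
(T3 `mem_sumset_of_fullPos` + §1.) [folklore] -/
theorem stampLawAt_three_of_stamps {m N : ℕ} (hm : 1 ≤ m)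
    (hN : ∀ x : ℕ, ∃ r, r ≤ N + 1 ∧ ∀ p q : ℕ, p + q ≤ m → p + q * x ≠ r) :
    StampLawAt m 3 N := by
  intro d S hS hfull
  by_contra hdeg'
  have hdeg : N < (pencil d S).det.natDegree := not_le.mp hdeg'
  have hq : (pencil d S).det ≠ 0 := by
    intro h0
    rw [h0] at hdeg
    simp at hdeg
  -- every r ≤ natDegree is an m-fold sum of exponents
  have hmem : ∀ r, r ≤ (pencil d S).det.natDegree →
      ∃ s : Multiset (Fin 3), Multiset.card s = m ∧ (s.map d).sum = r := by
    intro r hr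
    have h := mem_sumset_of_fullPos d S hq hfull hr
    rw [Finset.mem_image] at h
    obtain ⟨s, -, hs⟩ := h
    exact ⟨(s : Multiset (Fin 3)), s.2, hs⟩
  -- values {0, 1, x}
  obtain ⟨s0, hs0c, hs0⟩ := hmem 0 (Nat.zero_le _)
  obtain ⟨a, ha⟩ := exists_eq_zero_of_sum_eq_zero d s0
    (by intro h; rw [h] at hs0c; simp at hs0c; omega) hs0
  obtain ⟨s1, -, hs1⟩ := hmem 1 (by omega)
  obtain ⟨b, hb⟩ := exists_eq_one_of_sum_eq_one d s1 hs1
  obtain ⟨x, hx⟩ := values_fin_three d a b ha hb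
  obtain ⟨r, hrN, hr⟩ := hN x
  obtain ⟨s, hsc, hs⟩ := hmem r (by omega)
  obtain ⟨p, q, hpq, hsum⟩ := sum_eq_stamps d x hx s
  exact hr p q (by omega) (by omega)

/-! ## §3 The numeric rows `m = 2, …, 7`: `n(m,2) = 4, 7, 10, 14, 18, 23` (Stöhr `⌊(m²+6m+1)/4⌋`) -/

/-- Large second denomination: with `x ≥ m + 2`, the value `m + 1` is not `p + q·x` with `p + q ≤ m`. [folklore] -/
theorem not_rep_of_large {m x : ℕ} (hx : m + 2 ≤ x) : ∀ p q : ℕ, p + q ≤ m → p + q * x ≠ m + 1 := by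
  intro p q hpq h
  rcases Nat.eq_zero_or_pos q with hq | hq
  · subst hq; omega
  · have : x ≤ q * x := Nat.le_mul_of_pos_left x hq
    omega

/-- `ν(2,3) ≤ 4 = n(2,2)`. [folklore] -/
theorem stampLawAt_two_three : StampLawAt 2 3 4 := by
  refine stampLawAt_three_of_stamps (by norm_num) fun x => ?_
  rcases Nat.lt_or_ge x 4 with hx | hx
  · interval_cases x
    · exact ⟨3, by norm_num, fun p q hpq h => by omega⟩
    · exact ⟨3, by norm_num, fun p q hpq h => by omega⟩
    · exact ⟨5, by norm_num, fun p q hpq h => by omega⟩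
    · exact ⟨5, by norm_num, fun p q hpq h => by omega⟩
  · exact ⟨3, by norm_num, not_rep_of_large hx⟩

/-- **`ν(3,3) ≤ 7 = n(3,2)`** — with `fullyRealisable_three_013_seven`: `ν(3,3) = 7` EXACT. [folklore] -/
theorem stampLawAt_three_three : StampLawAt 3 3 7 := by
  refine stampLawAt_three_of_stamps (by norm_num) fun x => ?_
  rcases Nat.lt_or_ge x 5 with hx | hx
  · interval_cases x
    · exact ⟨4, by norm_num, fun p q hpq h => by omega⟩
    · exact ⟨4, by norm_num, fun p q hpq h => by omega⟩
    · exact ⟨7, by norm_num, fun p q hpq h => by omega⟩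
    · exact ⟨8, by norm_num, fun p q hpq h => by omega⟩
    · exact ⟨7, by norm_num, fun p q hpq h => by omega⟩
  · exact ⟨4, by norm_num, not_rep_of_large hx⟩

/-- **`ν(4,3) ≤ 10 = n(4,2)`** — with `fullyRealisable_four_013_ten`: `ν(4,3) = 10` EXACT. [folklore] -/
theorem stampLawAt_four_three : StampLawAt 4 3 10 := by
  refine stampLawAt_three_of_stamps (by norm_num) fun x => ?_
  rcases Nat.lt_or_ge x 6 with hx | hx
  · interval_cases x
    · exact ⟨5, by norm_num, fun p q hpq h => by omega⟩
    · exact ⟨5, by norm_num, fun p q hpq h => by omega⟩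
    · exact ⟨9, by norm_num, fun p q hpq h => by omega⟩
    · exact ⟨11, by norm_num, fun p q hpq h => by omega⟩
    · exact ⟨11, by norm_num, fun p q hpq h => by omega⟩
    · exact ⟨9, by norm_num, fun p q hpq h => by omega⟩
  · exact ⟨5, by norm_num, not_rep_of_large hx⟩

/-- **`ν(5,3) ≤ 14 = n(5,2)`** — with `fullyRealisable_five_014_fourteen`: `ν(5,3) = 14` EXACT. [folklore] -/
theorem stampLawAt_five_three : StampLawAt 5 3 14 := by
  refine stampLawAt_three_of_stamps (by norm_num) fun x => ?_
  rcases Nat.lt_or_ge x 7 with hx | hx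
  · interval_cases x
    · exact ⟨6, by norm_num, fun p q hpq h => by omega⟩
    · exact ⟨6, by norm_num, fun p q hpq h => by omega⟩
    · exact ⟨11, by norm_num, fun p q hpq h => by omega⟩
    · exact ⟨14, by norm_num, fun p q hpq h => by omega⟩
    · exact ⟨15, by norm_num, fun p q hpq h => by omega⟩
    · exact ⟨14, by norm_num, fun p q hpq h => by omega⟩
    · exact ⟨11, by norm_num, fun p q hpq h => by omega⟩
  · exact ⟨6, by norm_num, not_rep_of_large hx⟩

/-- `ν(6,3) ≤ 18 = n(6,2)` (realisation open: kit-class search). [folklore] -/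
theorem stampLawAt_six_three : StampLawAt 6 3 18 := by
  refine stampLawAt_three_of_stamps (by norm_num) fun x => ?_
  rcases Nat.lt_or_ge x 8 with hx | hx
  · interval_cases x
    · exact ⟨7, by norm_num, fun p q hpq h => by omega⟩
    · exact ⟨7, by norm_num, fun p q hpq h => by omega⟩
    · exact ⟨13, by norm_num, fun p q hpq h => by omega⟩
    · exact ⟨17, by norm_num, fun p q hpq h => by omega⟩
    · exact ⟨19, by norm_num, fun p q hpq h => by omega⟩
    · exact ⟨19, by norm_num, fun p q hpq h => by omega⟩
    · exact ⟨17, by norm_num, fun p q hpq h => by omega⟩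
    · exact ⟨13, by norm_num, fun p q hpq h => by omega⟩
  · exact ⟨7, by norm_num, not_rep_of_large hx⟩

/-- `ν(7,3) ≤ 23 = n(7,2)` (realisation open). [folklore] -/
theorem stampLawAt_seven_three : StampLawAt 7 3 23 := by
  refine stampLawAt_three_of_stamps (by norm_num) fun x => ?_
  rcases Nat.lt_or_ge x 9 with hx | hx
  · interval_cases x
    · exact ⟨8, by norm_num, fun p q hpq h => by omega⟩
    · exact ⟨8, by norm_num, fun p q hpq h => by omega⟩
    · exact ⟨15, by norm_num, fun p q hpq h => by omega⟩
    · exact ⟨20, by norm_num, fun p q hpq h => by omega⟩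
    · exact ⟨23, by norm_num, fun p q hpq h => by omega⟩
    · exact ⟨24, by norm_num, fun p q hpq h => by omega⟩
    · exact ⟨23, by norm_num, fun p q hpq h => by omega⟩
    · exact ⟨20, by norm_num, fun p q hpq h => by omega⟩
    · exact ⟨15, by norm_num, fun p q hpq h => by omega⟩
  · exact ⟨8, by norm_num, not_rep_of_large hx⟩

end Summit.ValiantsHypothesis.ValiantsHypothesis.Theorems.LacunarySymmetroidMatrixDescartes.FiniteSector
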